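import Literature.NumberTheory.EllipticCurves.TwoVariableSelmerDualNakayamaProofs
import Literature.Algebra.Module.CharacterModuleAnnihilator
import HarnessLib

/-!
# The double layers `X_Gr(E/K̃_∞)/(p, T₁)` and `X_Gr(E/K̃_∞)/(p, T₂)` are finite as soon as the corresponding
# torsion subgroups `S[p, T_i] = {s | p s = 0, conj_{γ_i} s = s}` of `H¹_{nr,v̄}(K̃_∞, E[p^∞])` are

PROOFS-ONLY (no definition, no named fact, no `sorry`, no instance). Cell `bsd-2adic`
(`run/shared/lean/pub/bsd-2adic/`), seat `bsd-2adic-tower-1` GEN 47, key «CTRL₂» (O2 stmt-BirchSwinnertonDyer-24728,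
line `two_variable_gv_squeeze_two`, stub R0T): the Pontryagin-duality step turning the control theorem for
`unrSelmer₂` (`TwoVariableControlLineFiniteProofs`: `S[p, T₁]` finite) into the FINITE DOUBLE LAYER
`X_Gr₂ ⧸ (p, T₁) X_Gr₂` consumed by the torsion / `μ = 0` doors (`Theorems/TwoAdicConverseBDPSelmerLowerDivisibility
AtTwoLineLift*`, `…CofiniteGeneration`).

For the character module `X = Hom(S, ℚ/ℤ)` of an `R`-module `S` and a finitely generated ideal `I = (a₁, …, aₙ)`,
restriction to `S[I]` kills exactly `I·X`, so `X/I·X ↪ Hom(S[I], ℚ/ℤ)` is finite when `S[I]` is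
(`Literature.Algebra.Module.natCard_quotient_smul_top_le`). Here `S = unrSelmer₂ κ₁ κ₂ E[p^∞] v̄` with its
`Λ₂ = ℤ_p⟦T₂⟧⟦T₁⟧`-structure `IsLocNil₂.selfModule` (`T₁ = X ↦ conj_{γ₁} − 1`, `T₂ = C X ↦ conj_{γ₂} − 1`),
`X = W.XGr₂` (the SAME abelian group with the `Λ₂`-structure `module₂`, identified `Λ₂`-linearly with Mathlib's
`CharacterModule S` by GEN 46's `IsLocNil₂.nonempty_characterModule_linearEquiv_dual`), and `I = (p, T₁)` resp.
`(p, T₂)`, whose torsion subgroup is `{s | p s = 0, conj_{γ_i} s = s}`. Greenberg p. 60 "`X/𝔪X` finite" with `𝔪`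
replaced by `(p, T_i)`; Washington §13.2 (`M/(p, T)`).
[GreenbergLNM1716] §1 p. 60; [Washington1997] §13.2; [Rubin1991] §4 p. 36.
-/

noncomputable section

open scoped Classical

open NumberField IsDedekindDomain Field PowerSeries
open Literature.NumberTheory.EllipticCurves Literature.NumberTheory.EllipticCurves.TwoVariableSelmer
  Literature.NumberTheory.EllipticCurves.IwasawaDual

namespace WeierstrassCurve

namespace XGr₂

variable {K : Type} [Field K] [NumberField K] (W : WeierstrassCurve K) (p : ℕ) [Fact p.Prime]
  (κ₁ κ₂ : ZpExtension K p) (vbar : HeightOneSpectrum (𝓞 K))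
  (γ₁ γ₂ : Field.absoluteGaloisGroup K) [hγ : Fact (ZpExtension.IsTopGeneratorPair κ₁ κ₂ γ₁ γ₂)]

/-- `C (C (p : ℤ_p)) = p` in `Λ₂ = ℤ_p⟦T₂⟧⟦T₁⟧` (both `C`'s are ring maps). [folklore] -/
private theorem C_C_natCast : (C (C (p : ℤ_[p])) : IwasawaAlgebra₂ p) = (p : IwasawaAlgebra₂ p) := by
  rw [show (p : ℤ_[p]) = ((p : ℕ) : ℤ_[p]) from rfl, map_natCast, map_natCast]

/-- `Set.range ![a, b] = {a, b}`. [folklore] -/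
private theorem range_vecCons_two {α : Type} (a b : α) : Set.range ![a, b] = {a, b} := by
  ext x
  simp only [Set.mem_range, Set.mem_insert_iff, Set.mem_singleton_iff]
  constructor
  · rintro ⟨i, rfl⟩
    fin_cases i
    · exact Or.inl rfl
    · exact Or.inr rfl
  · rintro (rfl | rfl)
    · exact ⟨0, rfl⟩
    · exact ⟨1, rfl⟩

/-- **The finite double layer along `T₁`: `X_Gr(E/K̃_∞) ⧸ (p, T₁) X_Gr(E/K̃_∞)` is finite as soon as
`{s ∈ H¹_{nr,v̄}(K̃_∞, E[p^∞]) | p s = 0, conj_{γ₁} s = s}` is** (any number field `K` in universe `0`, any `W`,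
`p`, pair, `v̄`): Pontryagin duality `X/(p,T₁)X ↪ Hom(S[p, T₁], ℚ/ℤ)` (`natCard_quotient_smul_top_le` for the ideal
generated by `![p, T₁]`, transported from Mathlib's `CharacterModule S` to `X_Gr₂` along GEN 46's `Λ₂`-linear
identification). With COFGEN₂ this finite double layer gives `X_Gr₂` torsion and `μ = 0` along `T₁ = 0`
(Summits doors `xGr₂_isTorsion_of_finite_quotient_p_X'`, `map_residue_toUnr₂_ne_zero_…_p_X`).
[cite: GreenbergLNM1716, §1 p. 60 (after Conj. 1.3)] [cite: Washington1997, §13.2] -/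
theorem finite_quotient_p_X_of_finite
    (hfin : Set.Finite {s : unrSelmer₂ κ₁ κ₂ (geomPrimaryTorsion W p) vbar |
      p • s = 0 ∧ conjSel₂ κ₁ κ₂ (geomPrimaryTorsion W p) vbar γ₁ s = s}) :
    Finite (W.XGr₂ p κ₁ κ₂ vbar γ₁ γ₂ ⧸
      ((Ideal.span ({C (C (p : ℤ_[p])), X} : Set (IwasawaAlgebra₂ p))) •
        (⊤ : Submodule (IwasawaAlgebra₂ p) (W.XGr₂ p κ₁ κ₂ vbar γ₁ γ₂)))) := by
  have h := isLocNil₂_conjSel₂ (geomPrimaryTorsion W p) vbar hγ.out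
    (W.exists_pow_smul_geomPrimaryTorsion_eq_zero p) (W.isOpen_stabilizer_geomPrimaryTorsion' p)
  letI := h.selfModule
  -- the generating family `![p, T₁]` of the ideal `(p, T₁)`
  set a : Fin 2 → IwasawaAlgebra₂ p := ![C (C (p : ℤ_[p])), X] with ha
  have hI : (Ideal.span ({C (C (p : ℤ_[p])), X} : Set (IwasawaAlgebra₂ p))) = Ideal.span (Set.range a) := by
    rw [ha, range_vecCons_two]
  -- `S[(p, T₁)]` is finite
  haveI : Finite (Submodule.torsionBySet (IwasawaAlgebra₂ p)
      (unrSelmer₂ κ₁ κ₂ (geomPrimaryTorsion W p) vbar) (Set.range a)) := by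
    refine (hfin.subset fun s hs ↦ ?_).to_subtype
    rw [SetLike.mem_coe, Submodule.mem_torsionBySet_iff] at hs
    refine ⟨?_, ?_⟩
    · have h1 := hs ⟨C (C (p : ℤ_[p])), ⟨0, rfl⟩⟩
      change (C (C (p : ℤ_[p])) : IwasawaAlgebra₂ p) • s = 0 at h1
      rwa [C_C_natCast, Nat.cast_smul_eq_nsmul] at h1
    · have h2 := hs ⟨X, ⟨1, rfl⟩⟩
      change (X : IwasawaAlgebra₂ p) • s = 0 at h2
      rwa [h.X_smul, IwasawaDual.End_sub_apply, AddMonoid.End.one_apply, sub_eq_zero] at h2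
  -- the quotient of `CharacterModule S` is finite
  haveI hq := (Literature.Algebra.Module.natCard_quotient_smul_top_le (R := IwasawaAlgebra₂ p)
    (M := unrSelmer₂ κ₁ κ₂ (geomPrimaryTorsion W p) vbar) a).1
  -- transport along the `Λ₂`-linear identification `CharacterModule S ≃ X_Gr₂`
  obtain ⟨e₀⟩ := h.nonempty_characterModule_linearEquiv_dual
  have e : CharacterModule (unrSelmer₂ κ₁ κ₂ (geomPrimaryTorsion W p) vbar) ≃ₗ[IwasawaAlgebra₂ p]
      W.XGr₂ p κ₁ κ₂ vbar γ₁ γ₂ := e₀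
  have hmap : (Ideal.span (Set.range a) • (⊤ : Submodule (IwasawaAlgebra₂ p)
      (CharacterModule (unrSelmer₂ κ₁ κ₂ (geomPrimaryTorsion W p) vbar)))).map
        (e : CharacterModule (unrSelmer₂ κ₁ κ₂ (geomPrimaryTorsion W p) vbar) →ₗ[IwasawaAlgebra₂ p]
          W.XGr₂ p κ₁ κ₂ vbar γ₁ γ₂) =
      Ideal.span (Set.range a) • (⊤ : Submodule (IwasawaAlgebra₂ p) (W.XGr₂ p κ₁ κ₂ vbar γ₁ γ₂)) := by
    rw [Submodule.map_smul'', Submodule.map_top, LinearEquiv.range]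
  rw [hI]
  exact Finite.of_equiv _ (Submodule.Quotient.equiv _ _ e hmap).toEquiv

/-- **The finite double layer along `T₂`** (the symmetric statement, `conj_{γ₂}` and `C X` in place of
`conj_{γ₁}` and `X`): `{s | p s = 0, conj_{γ₂} s = s}` finite ⇒ `X_Gr₂ ⧸ (p, T₂) X_Gr₂` finite.
[cite: GreenbergLNM1716, §1 p. 60 (after Conj. 1.3)] [cite: Washington1997, §13.2] -/
theorem finite_quotient_p_CX_of_finite
    (hfin : Set.Finite {s : unrSelmer₂ κ₁ κ₂ (geomPrimaryTorsion W p) vbar |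
      p • s = 0 ∧ conjSel₂ κ₁ κ₂ (geomPrimaryTorsion W p) vbar γ₂ s = s}) :
    Finite (W.XGr₂ p κ₁ κ₂ vbar γ₁ γ₂ ⧸
      ((Ideal.span ({C (C (p : ℤ_[p])), C X} : Set (IwasawaAlgebra₂ p))) •
        (⊤ : Submodule (IwasawaAlgebra₂ p) (W.XGr₂ p κ₁ κ₂ vbar γ₁ γ₂)))) := by
  have h := isLocNil₂_conjSel₂ (geomPrimaryTorsion W p) vbar hγ.out
    (W.exists_pow_smul_geomPrimaryTorsion_eq_zero p) (W.isOpen_stabilizer_geomPrimaryTorsion' p)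
  letI := h.selfModule
  set a : Fin 2 → IwasawaAlgebra₂ p := ![C (C (p : ℤ_[p])), C X] with ha
  have hI : (Ideal.span ({C (C (p : ℤ_[p])), C X} : Set (IwasawaAlgebra₂ p))) = Ideal.span (Set.range a) := by
    rw [ha, range_vecCons_two]
  haveI : Finite (Submodule.torsionBySet (IwasawaAlgebra₂ p)
      (unrSelmer₂ κ₁ κ₂ (geomPrimaryTorsion W p) vbar) (Set.range a)) := by
    refine (hfin.subset fun s hs ↦ ?_).to_subtype
    rw [SetLike.mem_coe, Submodule.mem_torsionBySet_iff] at hs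
    refine ⟨?_, ?_⟩
    · have h1 := hs ⟨C (C (p : ℤ_[p])), ⟨0, rfl⟩⟩
      change (C (C (p : ℤ_[p])) : IwasawaAlgebra₂ p) • s = 0 at h1
      rwa [C_C_natCast, Nat.cast_smul_eq_nsmul] at h1
    · have h2 := hs ⟨C X, ⟨1, rfl⟩⟩
      change (C X : IwasawaAlgebra₂ p) • s = 0 at h2
      rwa [h.C_X_smul, IwasawaDual.End_sub_apply, AddMonoid.End.one_apply, sub_eq_zero] at h2
  haveI hq := (Literature.Algebra.Module.natCard_quotient_smul_top_le (R := IwasawaAlgebra₂ p)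
    (M := unrSelmer₂ κ₁ κ₂ (geomPrimaryTorsion W p) vbar) a).1
  obtain ⟨e₀⟩ := h.nonempty_characterModule_linearEquiv_dual
  have e : CharacterModule (unrSelmer₂ κ₁ κ₂ (geomPrimaryTorsion W p) vbar) ≃ₗ[IwasawaAlgebra₂ p]
      W.XGr₂ p κ₁ κ₂ vbar γ₁ γ₂ := e₀
  have hmap : (Ideal.span (Set.range a) • (⊤ : Submodule (IwasawaAlgebra₂ p)
      (CharacterModule (unrSelmer₂ κ₁ κ₂ (geomPrimaryTorsion W p) vbar)))).map
        (e : CharacterModule (unrSelmer₂ κ₁ κ₂ (geomPrimaryTorsion W p) vbar) →ₗ[IwasawaAlgebra₂ p]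
          W.XGr₂ p κ₁ κ₂ vbar γ₁ γ₂) =
      Ideal.span (Set.range a) • (⊤ : Submodule (IwasawaAlgebra₂ p) (W.XGr₂ p κ₁ κ₂ vbar γ₁ γ₂)) := by
    rw [Submodule.map_smul'', Submodule.map_top, LinearEquiv.range]
  rw [hI]
  exact Finite.of_equiv _ (Submodule.Quotient.equiv _ _ e hmap).toEquiv

end XGr₂

end WeierstrassCurve

end
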